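import Summits.Ventures.CertifiedManyBodySolver.Observables.SpinCorrelatorRange

/-!
# Algebra of the fermion spin operators for the star inequality

HONEST FRAMING: objects and exact identities only; no bound on any Hubbard state is claimed in this
file (first certified bounds are the programme; this is not a superconductivity verdict).  Speedrun
`mbsolver`, seat sr-mbsolver-m3-2, gen 9; consumed by `SpinStarInequality`.

Contents (all on an arbitrary finite lattice `Λ` of spin-½ fermions, `S^±_x, S^z_x, m_x` as in
`Literature.MathematicalPhysics.QuantumLattice.HubbardLocalSpinOperators` / `HubbardSpinMomentBounds`,
`σ^z_x = n_{x↑} - n_{x↓} = 2 S^z_x`):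

* the abstract **star identity** `star_core`: in any ring, the on-site spin-½ relations for
  `P, M, Zd, m` (`S⁺_x, S⁻_x, σ^z_x, m_x`), their commutation with `LP, LM, LZd` (`Σ_Y S⁺, Σ_Y S⁻, Σ_Y σ^z`)
  and the `su(2)` relations of the latter give `𝒢² = m·(4𝐋²) - 2𝒢` for `𝒢 = 2 P LM + 2 M LP + Zd LZd`;
* the on-site multiplication table (`S⁺S⁺ = 0`, `n_↑ S⁺ = S⁺`, `σ^z S⁺ = S⁺ = -S⁺ σ^z`, …,
  `S⁺S⁻ ± S⁻S⁺ = m, σ^z`), from the CAR;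
* commutation of the local spin operators of distinct sites (`commute_bilinear_of_ne` from
  `LiebThm1.creation_mul_annihilation_commutator`) and of `m_x` with `𝐒_y·𝐒_{y'}`;
* the `su(2)` relations of the partial sums `Σ_{y∈Y} S^±_y, Σ_{y∈Y} σ^z_y`.

References: [EsslerEtAl2005, §2.2.5] (local spin and moment operators of the Hubbard model);
[Tasaki2020, App. A.3].
-/

namespace Summit.Ventures.CertifiedManyBodySolver.Observables

open Matrix Literature.MathematicalPhysics.QuantumLattice Literature.Probability.LatticeModels
open Literature.MathematicalPhysics.QuantumLattice.HubbardWave0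
open Literature.MathematicalPhysics.QuantumLattice.FermionTorus
open Literature.MathematicalPhysics.QuantumLattice.FermionSpinMoment
open scoped BigOperators ComplexConjugate ComplexOrder

namespace SpinStar

/-! ### An abstract ring identity: the square of a star operator -/

/-- **The star identity, abstract form.**  In any ring, if `P, M, Zd, m` ("`S⁺_x, S⁻_x, σ^z_x, m_x`")
satisfy the on-site spin-½ fermion algebra, commute with `LP, LM, LZd` ("`Σ_Y S⁺, Σ_Y S⁻, Σ_Y σ^z`"), and
the latter satisfy the `su(2)` relations, then `𝒢 = 2 P LM + 2 M LP + Zd LZd` (`= 4 Σ_Y 𝐒_x·𝐒_y`) obeys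
`𝒢² = m (2 LP LM + 2 LM LP + LZd²) - 2 𝒢` (`= m · 4𝐋² - 2𝒢`). -/
theorem star_core {A : Type*} [Ring A] (P M Zd m LP LM LZd : A)
    (hPP : P * P = 0) (hMM : M * M = 0) (hPMs : P * M + M * P = m) (hPMd : P * M - M * P = Zd)
    (hZdP : Zd * P = P) (hPZd : P * Zd = -P) (hZdM : Zd * M = -M) (hMZd : M * Zd = M)
    (hZdZd : Zd * Zd = m)
    (cP1 : LP * P = P * LP) (cP2 : LM * P = P * LM) (cP3 : LZd * P = P * LZd)
    (cM1 : LP * M = M * LP) (cM2 : LM * M = M * LM) (cM3 : LZd * M = M * LZd)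
    (cZ1 : LP * Zd = Zd * LP) (cZ2 : LM * Zd = Zd * LM) (cZ3 : LZd * Zd = Zd * LZd)
    (hL1 : LM * LP - LP * LM = -LZd) (hL2 : LP * LZd - LZd * LP = -(LP + LP))
    (hL3 : LZd * LM - LM * LZd = -(LM + LM)) :
    (P * LM + P * LM + (M * LP + M * LP) + Zd * LZd) * (P * LM + P * LM + (M * LP + M * LP) + Zd * LZd) =
      m * (LP * LM + LP * LM + (LM * LP + LM * LP) + LZd * LZd) -
        (P * LM + P * LM + (M * LP + M * LP) + Zd * LZd + (P * LM + P * LM + (M * LP + M * LP) + Zd * LZd)) := by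
  have sw : ∀ {X B L L' : A}, L * B = B * L → X * L * (B * L') = X * B * (L * L') := by
    intro X B L L' h
    rw [mul_assoc, ← mul_assoc L, h, mul_assoc, mul_assoc]
  calc (P * LM + P * LM + (M * LP + M * LP) + Zd * LZd) * (P * LM + P * LM + (M * LP + M * LP) + Zd * LZd)
      = 4 • (P * LM * (P * LM)) + 4 • (P * LM * (M * LP)) + 4 • (M * LP * (P * LM)) + 4 • (M * LP * (M * LP))
        + 2 • (P * LM * (Zd * LZd)) + 2 • (M * LP * (Zd * LZd)) + 2 • (Zd * LZd * (P * LM))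
        + 2 • (Zd * LZd * (M * LP)) + Zd * LZd * (Zd * LZd) := by noncomm_ring
    _ = 4 • (P * P * (LM * LM)) + 4 • (P * M * (LM * LP)) + 4 • (M * P * (LP * LM)) + 4 • (M * M * (LP * LP))
        + 2 • (P * Zd * (LM * LZd)) + 2 • (M * Zd * (LP * LZd)) + 2 • (Zd * P * (LZd * LM))
        + 2 • (Zd * M * (LZd * LP)) + Zd * Zd * (LZd * LZd) := by
          rw [sw cP2, sw cM2, sw cP1, sw cM1, sw cZ2, sw cZ1, sw cP3, sw cM3, sw cZ3]
    _ = 2 • ((P * M + M * P) * (LM * LP + LP * LM)) + 2 • ((P * M - M * P) * (LM * LP - LP * LM))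
        + 2 • (P * (LZd * LM - LM * LZd)) + 2 • (M * (LP * LZd - LZd * LP)) + m * (LZd * LZd) := by
          rw [hPP, hMM, hPZd, hMZd, hZdP, hZdM, hZdZd]
          noncomm_ring
    _ = 2 • (m * (LM * LP + LP * LM)) + 2 • (Zd * -LZd) + 2 • (P * -(LM + LM)) + 2 • (M * -(LP + LP))
        + m * (LZd * LZd) := by rw [hPMs, hPMd, hL1, hL2, hL3]
    _ = m * (LP * LM + LP * LM + (LM * LP + LM * LP) + LZd * LZd) -
        (P * LM + P * LM + (M * LP + M * LP) + Zd * LZd + (P * LM + P * LM + (M * LP + M * LP) + Zd * LZd)) := by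
          noncomm_ring

/-! ### The on-site algebra of `S⁺_x, S⁻_x, σ^z_x = n_{x↑} - n_{x↓}` and `m_x` -/

section Local

variable {Λ : Type*} [LinearOrder Λ] [Fintype Λ]

omit [LinearOrder Λ] [Fintype Λ] in
/-- Distinct sites have distinct orbitals. -/
private theorem orb_ne_of_ne {x y : Λ} (hxy : x ≠ y) (σ τ : Fin 2) : orb x σ ≠ orb y τ :=
  fun h => hxy (orb_eq_orb_iff.1 h).1

omit [LinearOrder Λ] [Fintype Λ] in
/-- The two orbitals of one site are distinct. -/
private theorem orb_zero_ne_orb_one (x : Λ) : orb x 0 ≠ orb x 1 :=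
  fun h => absurd (orb_eq_orb_iff.1 h).2 (by decide)

/-- `S⁺_x S⁺_x = 0` (Pauli). -/
theorem fermionSpinPlus_mul_self (x : Λ) : fermionSpinPlus x * fermionSpinPlus x = 0 := by
  rw [fermionSpinPlus_def, creation_annihilation_mul_creation_annihilation_of_ne (orb_zero_ne_orb_one x).symm,
    creation_mul_self, zero_mul, zero_mul]

/-- `S⁻_x S⁻_x = 0` (Pauli). -/
theorem fermionSpinMinus_mul_self (x : Λ) : fermionSpinMinus x * fermionSpinMinus x = 0 := by
  rw [fermionSpinMinus_def, creation_annihilation_mul_creation_annihilation_of_ne (orb_zero_ne_orb_one x),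
    creation_mul_self, zero_mul, zero_mul]

/-- `n_{x↑} S⁺_x = S⁺_x`. -/
theorem numberOp_up_mul_fermionSpinPlus (x : Λ) : numberOp x 0 * fermionSpinPlus x = fermionSpinPlus x := by
  rw [numberOp, fermionSpinPlus_def]
  calc creation (orb x 0) * annihilation (orb x 0) * (creation (orb x 0) * annihilation (orb x 1))
      = creation (orb x 0) * (annihilation (orb x 0) * creation (orb x 0)) * annihilation (orb x 1) := by
        noncomm_ring
    _ = creation (orb x 0) * annihilation (orb x 1) := by
        rw [annihilation_mul_creation, if_pos rfl, mul_sub, mul_one, sub_mul, ← mul_assoc, creation_mul_self,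
          zero_mul, zero_mul, sub_zero]

/-- `n_{x↓} S⁺_x = 0`. -/
theorem numberOp_down_mul_fermionSpinPlus (x : Λ) : numberOp x 1 * fermionSpinPlus x = 0 := by
  rw [numberOp, fermionSpinPlus_def,
    creation_annihilation_mul_creation_annihilation_of_ne (orb_zero_ne_orb_one x).symm, mul_assoc,
    LiebThm1.annihilation_mul_self, mul_zero]

/-- `S⁺_x n_{x↑} = 0`. -/
theorem fermionSpinPlus_mul_numberOp_up (x : Λ) : fermionSpinPlus x * numberOp x 0 = 0 := by
  rw [numberOp, fermionSpinPlus_def,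
    creation_annihilation_mul_creation_annihilation_of_ne (orb_zero_ne_orb_one x).symm, creation_mul_self,
    zero_mul, zero_mul]

/-- `S⁺_x n_{x↓} = S⁺_x`. -/
theorem fermionSpinPlus_mul_numberOp_down (x : Λ) : fermionSpinPlus x * numberOp x 1 = fermionSpinPlus x := by
  rw [numberOp, fermionSpinPlus_def, mul_assoc, SusyTJ.annihilation_mul_number_self]

/-- `n_{x↑} S⁻_x = 0`. -/
theorem numberOp_up_mul_fermionSpinMinus (x : Λ) : numberOp x 0 * fermionSpinMinus x = 0 := by
  rw [numberOp, fermionSpinMinus_def,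
    creation_annihilation_mul_creation_annihilation_of_ne (orb_zero_ne_orb_one x), mul_assoc,
    LiebThm1.annihilation_mul_self, mul_zero]

/-- `n_{x↓} S⁻_x = S⁻_x`. -/
theorem numberOp_down_mul_fermionSpinMinus (x : Λ) :
    numberOp x 1 * fermionSpinMinus x = fermionSpinMinus x := by
  rw [numberOp, fermionSpinMinus_def]
  calc creation (orb x 1) * annihilation (orb x 1) * (creation (orb x 1) * annihilation (orb x 0))
      = creation (orb x 1) * (annihilation (orb x 1) * creation (orb x 1)) * annihilation (orb x 0) := by
        noncomm_ring
    _ = creation (orb x 1) * annihilation (orb x 0) := by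
        rw [annihilation_mul_creation, if_pos rfl, mul_sub, mul_one, sub_mul, ← mul_assoc, creation_mul_self,
          zero_mul, zero_mul, sub_zero]

/-- `S⁻_x n_{x↑} = S⁻_x`. -/
theorem fermionSpinMinus_mul_numberOp_up (x : Λ) : fermionSpinMinus x * numberOp x 0 = fermionSpinMinus x := by
  rw [numberOp, fermionSpinMinus_def, mul_assoc, SusyTJ.annihilation_mul_number_self]

/-- `S⁻_x n_{x↓} = 0`. -/
theorem fermionSpinMinus_mul_numberOp_down (x : Λ) : fermionSpinMinus x * numberOp x 1 = 0 := by
  rw [numberOp, fermionSpinMinus_def,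
    creation_annihilation_mul_creation_annihilation_of_ne (orb_zero_ne_orb_one x), creation_mul_self,
    zero_mul, zero_mul]

/-- `σ^z_x S⁺_x = S⁺_x` (`σ^z_x = n_{x↑} - n_{x↓} = 2 S^z_x`). -/
theorem sigmaZ_mul_fermionSpinPlus (x : Λ) :
    (numberOp x 0 - numberOp x 1) * fermionSpinPlus x = fermionSpinPlus x := by
  rw [sub_mul, numberOp_up_mul_fermionSpinPlus, numberOp_down_mul_fermionSpinPlus, sub_zero]

/-- `S⁺_x σ^z_x = -S⁺_x`. -/
theorem fermionSpinPlus_mul_sigmaZ (x : Λ) :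
    fermionSpinPlus x * (numberOp x 0 - numberOp x 1) = -fermionSpinPlus x := by
  rw [mul_sub, fermionSpinPlus_mul_numberOp_up, fermionSpinPlus_mul_numberOp_down, zero_sub]

/-- `σ^z_x S⁻_x = -S⁻_x`. -/
theorem sigmaZ_mul_fermionSpinMinus (x : Λ) :
    (numberOp x 0 - numberOp x 1) * fermionSpinMinus x = -fermionSpinMinus x := by
  rw [sub_mul, numberOp_up_mul_fermionSpinMinus, numberOp_down_mul_fermionSpinMinus, zero_sub]

/-- `S⁻_x σ^z_x = S⁻_x`. -/
theorem fermionSpinMinus_mul_sigmaZ (x : Λ) :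
    fermionSpinMinus x * (numberOp x 0 - numberOp x 1) = fermionSpinMinus x := by
  rw [mul_sub, fermionSpinMinus_mul_numberOp_up, fermionSpinMinus_mul_numberOp_down, sub_zero]

/-- `S⁺_x S⁻_x + S⁻_x S⁺_x = m_x`. -/
theorem fermionSpinPlus_mul_fermionSpinMinus_add (x : Λ) :
    fermionSpinPlus x * fermionSpinMinus x + fermionSpinMinus x * fermionSpinPlus x = localMoment x := by
  rw [fermionSpinPlus_mul_fermionSpinMinus, fermionSpinMinus_mul_fermionSpinPlus, localMoment, two_smul]
  abel

/-- `S⁺_x S⁻_x - S⁻_x S⁺_x = σ^z_x` (`[S⁺, S⁻] = 2 S^z` on one site). -/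
theorem fermionSpinPlus_mul_fermionSpinMinus_sub (x : Λ) :
    fermionSpinPlus x * fermionSpinMinus x - fermionSpinMinus x * fermionSpinPlus x = numberOp x 0 - numberOp x 1 := by
  rw [fermionSpinPlus_mul_fermionSpinMinus, fermionSpinMinus_mul_fermionSpinPlus]
  abel

/-- `σ^z_x S⁺_x - S⁺_x σ^z_x = 2 S⁺_x` (`[S^z, S⁺] = S⁺` on one site). -/
theorem sigmaZ_comm_fermionSpinPlus (x : Λ) :
    (numberOp x 0 - numberOp x 1) * fermionSpinPlus x - fermionSpinPlus x * (numberOp x 0 - numberOp x 1) =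
      fermionSpinPlus x + fermionSpinPlus x := by
  rw [sigmaZ_mul_fermionSpinPlus, fermionSpinPlus_mul_sigmaZ, sub_neg_eq_add]

/-- `σ^z_x S⁻_x - S⁻_x σ^z_x = -2 S⁻_x` (`[S^z, S⁻] = -S⁻` on one site). -/
theorem sigmaZ_comm_fermionSpinMinus (x : Λ) :
    (numberOp x 0 - numberOp x 1) * fermionSpinMinus x - fermionSpinMinus x * (numberOp x 0 - numberOp x 1) =
      -(fermionSpinMinus x + fermionSpinMinus x) := by
  rw [sigmaZ_mul_fermionSpinMinus, fermionSpinMinus_mul_sigmaZ]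
  abel

/-! ### Local spin operators of distinct sites commute -/

/-- Bilinears `c†_{xσ} c_{xτ}` and `c†_{yσ'} c_{yτ'}` of distinct sites commute (CAR). -/
theorem commute_bilinear_of_ne {x y : Λ} (hxy : x ≠ y) (σ τ σ' τ' : Fin 2) :
    Commute (creation (orb x σ) * annihilation (orb x τ)) (creation (orb y σ') * annihilation (orb y τ')) := by
  have h := LiebThm1.creation_mul_annihilation_commutator (orb x σ) (orb x τ) (orb y σ') (orb y τ')
  rw [if_neg (orb_ne_of_ne hxy τ σ'), if_neg (orb_ne_of_ne hxy σ τ'), sub_zero, sub_eq_zero] at h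
  exact h

/-- `[S⁺_x, S⁺_y] = 0` for `x ≠ y`. -/
theorem fermionSpinPlus_commute_fermionSpinPlus {x y : Λ} (hxy : x ≠ y) :
    Commute (fermionSpinPlus x) (fermionSpinPlus y) := commute_bilinear_of_ne hxy 0 1 0 1

/-- `[S⁺_x, S⁻_y] = 0` for `x ≠ y`. -/
theorem fermionSpinPlus_commute_fermionSpinMinus {x y : Λ} (hxy : x ≠ y) :
    Commute (fermionSpinPlus x) (fermionSpinMinus y) := commute_bilinear_of_ne hxy 0 1 1 0

/-- `[S⁻_x, S⁺_y] = 0` for `x ≠ y`. -/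
theorem fermionSpinMinus_commute_fermionSpinPlus {x y : Λ} (hxy : x ≠ y) :
    Commute (fermionSpinMinus x) (fermionSpinPlus y) := commute_bilinear_of_ne hxy 1 0 0 1

/-- `[S⁻_x, S⁻_y] = 0` for `x ≠ y`. -/
theorem fermionSpinMinus_commute_fermionSpinMinus {x y : Λ} (hxy : x ≠ y) :
    Commute (fermionSpinMinus x) (fermionSpinMinus y) := commute_bilinear_of_ne hxy 1 0 1 0

/-- `[n_{xσ}, S⁺_y] = 0` for `x ≠ y`. -/
theorem numberOp_commute_fermionSpinPlus {x y : Λ} (hxy : x ≠ y) (σ : Fin 2) :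
    Commute (numberOp x σ) (fermionSpinPlus y) := commute_bilinear_of_ne hxy σ σ 0 1

/-- `[n_{xσ}, S⁻_y] = 0` for `x ≠ y`. -/
theorem numberOp_commute_fermionSpinMinus {x y : Λ} (hxy : x ≠ y) (σ : Fin 2) :
    Commute (numberOp x σ) (fermionSpinMinus y) := commute_bilinear_of_ne hxy σ σ 1 0

/-- `[σ^z_x, S⁺_y] = 0` for `x ≠ y`. -/
theorem sigmaZ_commute_fermionSpinPlus {x y : Λ} (hxy : x ≠ y) :
    Commute (numberOp x 0 - numberOp x 1) (fermionSpinPlus y) :=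
  (numberOp_commute_fermionSpinPlus hxy 0).sub_left (numberOp_commute_fermionSpinPlus hxy 1)

/-- `[σ^z_x, S⁻_y] = 0` for `x ≠ y`. -/
theorem sigmaZ_commute_fermionSpinMinus {x y : Λ} (hxy : x ≠ y) :
    Commute (numberOp x 0 - numberOp x 1) (fermionSpinMinus y) :=
  (numberOp_commute_fermionSpinMinus hxy 0).sub_left (numberOp_commute_fermionSpinMinus hxy 1)

/-- `[σ^z_x, σ^z_y] = 0`. -/
theorem sigmaZ_commute_sigmaZ (x y : Λ) :
    Commute (numberOp x 0 - numberOp x 1) (numberOp y 0 - numberOp y 1) := by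
  have h : ∀ σ τ : Fin 2, Commute (numberOp x σ) (numberOp y τ) := fun σ τ =>
    numberAt_commute (orb x σ) (orb y τ)
  exact ((h 0 0).sub_right (h 0 1)).sub_left ((h 1 0).sub_right (h 1 1))

/-- `[m_x, 𝐒_y·𝐒_{y'}] = 0` for `x ≠ y, y'`. -/
theorem localMoment_commute_fermionSpinDot {x y y' : Λ} (hy : x ≠ y) (hy' : x ≠ y') :
    Commute (localMoment x) (fermionSpinDot y y') := by
  rw [fermionSpinDot_def]
  exact ((((localMoment_commute_fermionSpinPlus hy).mul_right (localMoment_commute_fermionSpinMinus hy')).add_right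
    ((localMoment_commute_fermionSpinMinus hy).mul_right (localMoment_commute_fermionSpinPlus hy'))).smul_right _).add_right
    ((localMoment_commute_fermionSpinZ x y).mul_right (localMoment_commute_fermionSpinZ x y'))

/-- `(𝐒_x·𝐒_y) m_x = 𝐒_x·𝐒_y` for `x ≠ y` (a spin operator at `x` requires `x` singly occupied). -/
theorem fermionSpinDot_mul_localMoment_left {x y : Λ} (hxy : x ≠ y) :
    fermionSpinDot x y * localMoment x = fermionSpinDot x y := by
  have hP : ∀ {X Z : Matrix (Finset (Orb Λ)) (Finset (Orb Λ)) ℂ}, X * localMoment x = X →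
      Commute (localMoment x) Z → X * Z * localMoment x = X * Z := by
    intro X Z hX hc
    rw [mul_assoc, ← hc.eq, ← mul_assoc, hX]
  rw [fermionSpinDot_def, add_mul, smul_mul_assoc, add_mul,
    hP (fermionSpinPlus_mul_localMoment x) (localMoment_commute_fermionSpinMinus hxy),
    hP (fermionSpinMinus_mul_localMoment x) (localMoment_commute_fermionSpinPlus hxy),
    hP (fermionSpinZ_mul_localMoment x) (localMoment_commute_fermionSpinZ x y)]

/-- `m_x (𝐒_x·𝐒_y) = 𝐒_x·𝐒_y` for `x ≠ y`. -/
theorem localMoment_mul_fermionSpinDot_left {x y : Λ} (hxy : x ≠ y) :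
    localMoment x * fermionSpinDot x y = fermionSpinDot x y := by
  have h := congrArg conjTranspose (fermionSpinDot_mul_localMoment_left hxy)
  rwa [conjTranspose_mul, (isHermitian_localMoment x).eq, conjTranspose_fermionSpinDot, fermionSpinDot_comm y x] at h

/-! ### The `su(2)` relations of the partial sums over `Y` -/

/-- `[Σ_Y S⁺, Σ_Y S⁻] = Σ_Y σ^z`. -/
theorem sum_fermionSpinPlus_comm_sum_fermionSpinMinus (Y : Finset Λ) :
    (∑ y ∈ Y, fermionSpinPlus y) * (∑ y ∈ Y, fermionSpinMinus y) -
        (∑ y ∈ Y, fermionSpinMinus y) * (∑ y ∈ Y, fermionSpinPlus y) =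
      ∑ y ∈ Y, (numberOp y 0 - numberOp y 1) := by
  rw [show (∑ y ∈ Y, fermionSpinMinus y) * (∑ y ∈ Y, fermionSpinPlus y) =
      ∑ y ∈ Y, ∑ y' ∈ Y, fermionSpinMinus y' * fermionSpinPlus y by rw [Finset.sum_mul_sum, Finset.sum_comm],
    Finset.sum_mul_sum, ← Finset.sum_sub_distrib]
  refine Finset.sum_congr rfl fun y hy => ?_
  rw [← Finset.sum_sub_distrib, Finset.sum_eq_single_of_mem y hy fun y' _ hne => ?_]
  · exact fermionSpinPlus_mul_fermionSpinMinus_sub y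
  · exact sub_eq_zero.mpr (fermionSpinPlus_commute_fermionSpinMinus hne.symm).eq

/-- `[Σ_Y σ^z, Σ_Y S⁺] = 2 Σ_Y S⁺`. -/
theorem sum_sigmaZ_comm_sum_fermionSpinPlus (Y : Finset Λ) :
    (∑ y ∈ Y, (numberOp y 0 - numberOp y 1)) * (∑ y ∈ Y, fermionSpinPlus y) -
        (∑ y ∈ Y, fermionSpinPlus y) * (∑ y ∈ Y, (numberOp y 0 - numberOp y 1)) =
      ∑ y ∈ Y, fermionSpinPlus y + ∑ y ∈ Y, fermionSpinPlus y := by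
  rw [show (∑ y ∈ Y, fermionSpinPlus y) * (∑ y ∈ Y, (numberOp y 0 - numberOp y 1)) =
      ∑ y ∈ Y, ∑ y' ∈ Y, fermionSpinPlus y' * (numberOp y 0 - numberOp y 1) by
        rw [Finset.sum_mul_sum, Finset.sum_comm],
    Finset.sum_mul_sum, ← Finset.sum_sub_distrib, ← Finset.sum_add_distrib]
  refine Finset.sum_congr rfl fun y hy => ?_
  rw [← Finset.sum_sub_distrib, Finset.sum_eq_single_of_mem y hy fun y' _ hne => ?_]
  · exact sigmaZ_comm_fermionSpinPlus y
  · exact sub_eq_zero.mpr (sigmaZ_commute_fermionSpinPlus hne.symm).eq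

/-- `[Σ_Y σ^z, Σ_Y S⁻] = -2 Σ_Y S⁻`. -/
theorem sum_sigmaZ_comm_sum_fermionSpinMinus (Y : Finset Λ) :
    (∑ y ∈ Y, (numberOp y 0 - numberOp y 1)) * (∑ y ∈ Y, fermionSpinMinus y) -
        (∑ y ∈ Y, fermionSpinMinus y) * (∑ y ∈ Y, (numberOp y 0 - numberOp y 1)) =
      -(∑ y ∈ Y, fermionSpinMinus y + ∑ y ∈ Y, fermionSpinMinus y) := by
  rw [show (∑ y ∈ Y, fermionSpinMinus y) * (∑ y ∈ Y, (numberOp y 0 - numberOp y 1)) =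
      ∑ y ∈ Y, ∑ y' ∈ Y, fermionSpinMinus y' * (numberOp y 0 - numberOp y 1) by
        rw [Finset.sum_mul_sum, Finset.sum_comm],
    Finset.sum_mul_sum, ← Finset.sum_sub_distrib, ← Finset.sum_add_distrib, ← Finset.sum_neg_distrib]
  refine Finset.sum_congr rfl fun y hy => ?_
  rw [← Finset.sum_sub_distrib, Finset.sum_eq_single_of_mem y hy fun y' _ hne => ?_]
  · exact sigmaZ_comm_fermionSpinMinus y
  · exact sub_eq_zero.mpr (sigmaZ_commute_fermionSpinMinus hne.symm).eq

end Local

end SpinStar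

end Summit.Ventures.CertifiedManyBodySolver.Observables
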